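import Summits.BirchSwinnertonDyer.BirchSwinnertonDyer.Theorems.AlignedTransportAtTwoMainConjectureOfRankZeroBSDAtTwoSexticTowerGrowth
import Summits.BirchSwinnertonDyer.BirchSwinnertonDyer.Theorems.AlignedTransportAtTwoMainConjectureOfRankZeroBSDAtTwoZpTowerChevalleyGrowth
import Literature.NumberTheory.IwasawaTheory.ClassicalLambdaInvariant
import Summits.BirchSwinnertonDyer.BirchSwinnertonDyer.Theorems.AlignedTransportAtTwoMainConjectureTransportAlignedAtTwoKilfordStratum
import Literature.NumberTheory.GaloisRepresentations.SplitsCompletelyCriteria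
import Literature.NumberTheory.EllipticCurves.HeegnerPointsImaginaryQuadraticProofs
import Literature.FieldTheory.Galois.SolvableCompositum
import HarnessLib

/-!
# Route `AlignedTransportAtTwo`, crux C2 `MainConjectureOfRankZeroBSDAtTwo` (stmt-BirchSwinnertonDyer-22298):
# THE IMAGINARY QUADRATIC INSTANCE OF CHEVALLEY GROWTH — `2` split in an imaginary quadratic `K` ⟹ `e_n < e_{n+1}` along the cyclotomic
# `ℤ₂`-tower and `μ = 0 ⟹ λ₂(K) ≥ 1` (Gold / Ferrero / Kida, by genus theory); the resolvent field `ℚ(√Δ_W)` of a Kilford seed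

HONEST FRAMING (cell `bsd-f1-sign2`, WIDTH-5 attached prover seat `bsd-line-att-p3` gen 26, line `birth`, lead `bsd-line-att-p2`; `--supports`
stmt-BirchSwinnertonDyer-22298, closes nothing; BSD is NOT proved; crux C2, its verdict «blocked-on `Rank1Residual.GreenbergMuConjectureIrreducible`» and
every registered stub untouched). THEOREMS ONLY — no definition, no named fact, no `sorry`. Third file of this gen: the `s = 2, u = 0` instance of g25's
`…ZpTowerChevalleyGrowth` (p751162), listed there as «the resolvent quadratic `ℚ(√Δ_W)` (`2` split: the classical `λ₂ ≥ 1`)» with displayed hypotheses.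
CROSS-CELL USE (cell `bsd-2adic`, crux `OrdLambdaHalfAtTwo`, line `kato_determinant_greenberg_two`): the meeting exponent
`TwoAdicKatoDeterminant.meetingExponentQ κK N := classicalLambda κK − 1 + Σ…` is an `ℕ`-subtraction whose junk-freeness «`λ₂(K) ≥ 1` for an imaginary
quadratic `K` in which `2` splits (Ferrero 1980 / Kida 1979)» was DOCUMENTED there but not a tree theorem; §1 below makes it one (granted `μ = 0`, the
currency of `classicalLambda`; `μ = 0` itself is Ferrero–Washington, tree named fact `ferreroWashington1979_classicalMuVanishes`).

WHAT.
* §1 (generic) `K` imaginary quadratic (`IsImaginaryQuadratic K`; unit rank `0` is the tree's `IsImaginaryQuadratic.unitsRank_eq_zero`) in which `2` splits completely (`SplitsCompletely K 2`, equivalently two primes above `2`,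
  e.g. from `SatisfiesHeegnerHypothesis (2N) K`), `κ` ANY cyclotomic `ℤ₂`-extension of `K`: **`classNumberPExp_zero_add_le_layer_of_isImaginaryQuadratic`**
  (`e_0 + n ≤ e_n + log₂ #μ(K)`), **`classNumberPExp_lt_succ_of_isImaginaryQuadratic`** (`e_n < e_{n+1}` for every `n`), **`one_le_classicalLambda_of_isImaginaryQuadratic`**
  (`μ = 0 ⟹ 1 ≤ classicalLambda κ`), `classicalMuVanishes_iff_one_le_classicalLambda_…`, `classicalLambda_sub_one_add_one_…` (the `ℕ`-subtraction of
  `meetingExponentQ` is junk-free), the `SatisfiesHeegnerHypothesis` forms, and the Ferrero–Washington-discharged form (named fact as hypothesis).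
* §2 (crux C2) the RESOLVENT FIELD `ℚ(δ)`, `δ² = Δ_W < 0`, of a seed-cell curve ON the Kilford stratum (`Δ_W ∈ ℚ₂ײ`, tree
  `isSquare_padic_Δ_of_onKilfordStratumAtTwo`): imaginary quadratic with `2` split (an embedding `ℚ(δ) → ℚ₂` + this gen's Galois count), so every cyclotomic
  `ℤ₂`-extension of `ℚ(√Δ_W)` has `e_n < e_{n+1}` and `μ = 0 ⟹ λ₂ ≥ 1`.

References: [Lang1990] Ch. 13 §4 L4.1–4.2, Ch. 5 §1 Thm. 1.2; [Washington1997] §13.1, §13.3 Thm. 13.13, Prop. 4.11; [Fukuda1994] Thm. 1 (1); [Ferrero1978] §1;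
[FerreroWashington1979]; [NeukirchANT1999] Ch. I §8 (8.2)–(8.3), Ch. II §8; [Marcus2018] Ch. 3 Thm. 21, Ch. 4; R. Gold, *The nontriviality of certain
ℤ_ℓ-extensions*, J. Number Theory 6 (1974) 369–373 (the statement `λ ≥ 1`; not held); tree p751162 (g25), this gen's `…SexticTowerGrowth`.
-/

set_option linter.dupNamespace false
set_option autoImplicit false

noncomputable section

open scoped Classical NumberField nonZeroDivisors

namespace Summit.BirchSwinnertonDyer.BirchSwinnertonDyer.Theorems.AlignedTransportAtTwoGreenbergFieldLambda

open NumberField IsDedekindDomain Polynomial IntermediateField Field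
  Literature.NumberTheory.EllipticCurves Literature.NumberTheory.GaloisRepresentations
  Literature.NumberTheory.IwasawaTheory
  Summit.BirchSwinnertonDyer.BirchSwinnertonDyer.Theorems.AlignedTransportAtTwoZpTowerChevalleyGrowth
  Summit.BirchSwinnertonDyer.BirchSwinnertonDyer.Theorems.AlignedTransportAtTwoSexticTowerGrowth

/-! ## §1 Imaginary quadratic `K`, `2` split: `e_0 + n ≤ e_n + log₂ #μ(K)`, `e_n < e_{n+1}`, `μ = 0 ⟹ λ ≥ 1` -/

section ImaginaryQuadratic

variable {K : Type} [Field K] [NumberField K]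

/-- `2` split completely in `K` ⟹ every height-one prime above `2` has `e = 1` (unramified). [cite: Marcus2018, Ch. 3 Thm. 21] -/
theorem forall_ramificationIdx_eq_one_of_splitsCompletely_two (h2 : SplitsCompletely K 2) :
    ∀ w : HeightOneSpectrum (𝓞 K), ((2 : ℕ) : 𝓞 K) ∈ w.asIdeal → w.asIdeal.ramificationIdx ℤ = 1 := fun w hw ↦ by
  haveI := w.isPrime
  haveI := liesOver_span_of_natCast_mem_asIdeal Nat.prime_two w hw
  exact (Algebra.isUnramifiedIn_iff_forall_ramificationIdx_eq_one.mp h2.1) w.asIdeal inferInstance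

/-- `2` split completely in the quadratic field `K` ⟹ at least (indeed exactly) two height-one primes above `2`. [cite: Marcus2018, Ch. 3 Thm. 21] -/
theorem two_le_ncard_of_splitsCompletely_two (hK2 : Module.finrank ℚ K = 2) (h2 : SplitsCompletely K 2) :
    2 ≤ {w : HeightOneSpectrum (𝓞 K) | ((2 : ℕ) : 𝓞 K) ∈ w.asIdeal}.ncard := by
  have hn : ((Ideal.span {(2 : ℤ)}).primesOver (𝓞 K)).ncard = 2 := by
    have h := ncard_primesOver_eq_finrank_of_splitsCompletely (K := K) Nat.prime_two h2
    rw [hK2] at h; exact_mod_cast h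
  obtain ⟨P₁, P₂, hne, hP⟩ := Set.ncard_eq_two.mp hn
  have hP₁ : P₁ ∈ (Ideal.span {(2 : ℤ)}).primesOver (𝓞 K) := by rw [hP]; exact Set.mem_insert _ _
  have hP₂ : P₂ ∈ (Ideal.span {(2 : ℤ)}).primesOver (𝓞 K) := by rw [hP]; exact Set.mem_insert_of_mem _ rfl
  have h0 : (Ideal.span {(2 : ℤ)} : Ideal ℤ) ≠ ⊥ := by rw [Ne, Ideal.span_singleton_eq_bot]; norm_num
  haveI := hP₁.1
  haveI := hP₂.1
  haveI := hP₁.2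
  haveI := hP₂.2
  have hP₁0 : P₁ ≠ ⊥ := Ideal.ne_bot_of_liesOver_of_ne_bot h0 P₁
  have hP₂0 : P₂ ≠ ⊥ := Ideal.ne_bot_of_liesOver_of_ne_bot h0 P₂
  set v₁ : HeightOneSpectrum (𝓞 K) := ⟨P₁, hP₁.1, hP₁0⟩
  set v₂ : HeightOneSpectrum (𝓞 K) := ⟨P₂, hP₂.1, hP₂0⟩
  have hv₁ : ((2 : ℕ) : 𝓞 K) ∈ v₁.asIdeal := natCast_mem_of_liesOver_span hP₁.2
  have hv₂ : ((2 : ℕ) : 𝓞 K) ∈ v₂.asIdeal := natCast_mem_of_liesOver_span hP₂.2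
  have hne' : v₁ ≠ v₂ := fun h ↦ hne (congrArg HeightOneSpectrum.asIdeal h)
  have h2' : ({v₁, v₂} : Set (HeightOneSpectrum (𝓞 K))).ncard = 2 := Set.ncard_eq_two.mpr ⟨v₁, v₂, hne', rfl⟩
  have hsub : ({v₁, v₂} : Set (HeightOneSpectrum (𝓞 K))) ⊆ {w : HeightOneSpectrum (𝓞 K) | ((2 : ℕ) : 𝓞 K) ∈ w.asIdeal} := by
    intro v hv
    simp only [Set.mem_insert_iff, Set.mem_singleton_iff] at hv
    rcases hv with rfl | rfl
    · exact hv₁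
    · exact hv₂
  exact h2'.symm.le.trans (Set.ncard_le_ncard hsub (Literature.NumberTheory.GaloisRepresentations.finite_setOf_natCast_mem (m := 2)))

/-- **Chevalley along the cyclotomic `ℤ₂`-tower of an imaginary quadratic field in which `2` splits: `e_0 + n ≤ e_n + log₂ #μ(K)`** for every `n` and
every cyclotomic `ℤ₂`-extension `κ` (g25's count at `s = 2`, `u = 0`, `4 ∤ 2`, `e = 1` above `2`). [cite: Lang1990, Ch. 13 §4, Lemma 4.1–4.2]
[cite: Washington1997, §13.1] -/
theorem classNumberPExp_zero_add_le_layer_of_isImaginaryQuadratic (hK : IsImaginaryQuadratic K) (h2 : SplitsCompletely K 2)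
    (κ : ZpExtension K 2) (hκ : κ.IsCyclotomic) (n : ℕ) :
    classNumberPExp κ 0 + n ≤ classNumberPExp κ n + Nat.log 2 (NumberField.Units.torsionOrder K) := by
  have h4 : ¬ 4 ∣ Module.finrank ℚ K := by rw [hK.1]; decide
  have hodd : ∀ w : HeightOneSpectrum (𝓞 K), ((2 : ℕ) : 𝓞 K) ∈ w.asIdeal → Odd (w.asIdeal.ramificationIdx ℤ) := fun w hw ↦ by
    rw [forall_ramificationIdx_eq_one_of_splitsCompletely_two h2 w hw]; exact odd_one
  have h := classNumberPExp_zero_add_le_layer_of_not_four_dvd h4 κ hκ hodd (two_le_ncard_of_splitsCompletely_two hK.1 h2) n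
  rw [hK.unitsRank_eq_zero] at h
  omega

/-- **THE JUMP: `e_n < e_{n+1}` for every `n`** along every cyclotomic `ℤ₂`-extension of an imaginary quadratic field in which `2` splits (`s = 2 ≥ u + 2 = 2`):
the `2`-class number of `K_n` at least doubles at every layer (Fukuda's index is `0`: both primes above `2` are totally ramified). [cite: Fukuda1994, Thm. 1 (1), p. 264]
[cite: Washington1997, Prop. 4.11] [cite: Lang1990, Ch. 13 §4, Lemma 4.1–4.2] -/
theorem classNumberPExp_lt_succ_of_isImaginaryQuadratic (hK : IsImaginaryQuadratic K) (h2 : SplitsCompletely K 2)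
    (κ : ZpExtension K 2) (hκ : κ.IsCyclotomic) (n : ℕ) : classNumberPExp κ n < classNumberPExp κ (n + 1) := by
  have h4 : ¬ 4 ∣ Module.finrank ℚ K := by rw [hK.1]; decide
  have hodd : ∀ w : HeightOneSpectrum (𝓞 K), ((2 : ℕ) : 𝓞 K) ∈ w.asIdeal → Odd (w.asIdeal.ramificationIdx ℤ) := fun w hw ↦ by
    rw [forall_ramificationIdx_eq_one_of_splitsCompletely_two h2 w hw]; exact odd_one
  have hsu : Units.rank K + 2 ≤ 2 := by rw [hK.unitsRank_eq_zero]
  exact classNumberPExp_lt_succ_of_not_four_dvd h4 κ hκ hodd (two_le_ncard_of_splitsCompletely_two hK.1 h2) hsu n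

/-- `e_n ≥ e_0 + n` (strict growth summed). [cite: Fukuda1994, Thm. 1 (1), p. 264] [cite: Washington1997, Prop. 4.11] -/
theorem classNumberPExp_zero_add_le_of_isImaginaryQuadratic (hK : IsImaginaryQuadratic K) (h2 : SplitsCompletely K 2)
    (κ : ZpExtension K 2) (hκ : κ.IsCyclotomic) (n : ℕ) : classNumberPExp κ 0 + n ≤ classNumberPExp κ n := by
  induction n with
  | zero => simp
  | succ n ih => have := classNumberPExp_lt_succ_of_isImaginaryQuadratic hK h2 κ hκ n; omega

/-- No class-number stabilisation certificate: `¬ ∃ n, e_{n+1} = e_n`. [cite: Fukuda1994, Thm. 1 (1), p. 264] -/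
theorem not_exists_classNumberPExp_succ_eq_of_isImaginaryQuadratic (hK : IsImaginaryQuadratic K) (h2 : SplitsCompletely K 2)
    (κ : ZpExtension K 2) (hκ : κ.IsCyclotomic) : ¬ ∃ n, classNumberPExp κ (n + 1) = classNumberPExp κ n := fun ⟨n, hn⟩ ↦
  (classNumberPExp_lt_succ_of_isImaginaryQuadratic hK h2 κ hκ n).ne' hn

/-- **`μ = 0 ⟹ λ ≥ 1`: any eventual growth law `e_n = l·n + ν` has `l ≥ 1`** (`s ≤ l + 1 + u`, `s = 2`, `u = 0`). [cite: Lang1990, Ch. 5 §1 Thm. 1.2 and Ch. 13 §4]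
[cite: Washington1997, §13.3 Thm. 13.13] -/
theorem one_le_of_linear_growth_of_isImaginaryQuadratic (hK : IsImaginaryQuadratic K) (h2 : SplitsCompletely K 2)
    (κ : ZpExtension K 2) (hκ : κ.IsCyclotomic) {l : ℕ} {ν : ℤ} {n₀ : ℕ}
    (hlin : ∀ n, n₀ ≤ n → (classNumberPExp κ n : ℤ) = l * n + ν) : 1 ≤ l := by
  have h4 : ¬ 4 ∣ Module.finrank ℚ K := by rw [hK.1]; decide
  have hodd : ∀ w : HeightOneSpectrum (𝓞 K), ((2 : ℕ) : 𝓞 K) ∈ w.asIdeal → Odd (w.asIdeal.ramificationIdx ℤ) := fun w hw ↦ by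
    rw [forall_ramificationIdx_eq_one_of_splitsCompletely_two h2 w hw]; exact odd_one
  have h := le_slope_of_linear_growth_of_not_four_dvd h4 κ hκ hodd (two_le_ncard_of_splitsCompletely_two hK.1 h2) hlin
  rw [hK.unitsRank_eq_zero] at h
  omega

/-- **`λ₂(K) ≥ 1` for an imaginary quadratic `K` in which `2` splits, granted `μ = 0`** (the currency of `classicalLambda`): `1 ≤ classicalLambda κ` for every
cyclotomic `ℤ₂`-extension `κ` of `K` with `ClassicalMuVanishes κ` (Gold 1974; Ferrero 1980 / Kida 1979 compute `λ₂`; here by genus theory). This is the fact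
DOCUMENTED (not proved) in cell bsd-2adic's `TwoAdicKatoDeterminant.meetingExponentQ` («`λ₂(K) ≥ 1` when `2` splits»). [cite: Washington1997, §13.3 Thm. 13.13]
[cite: Ferrero1978, §1 (Iwasawa invariants of abelian fields)] [cite: Lang1990, Ch. 13 §4, Lemma 4.1–4.2] -/
theorem one_le_classicalLambda_of_isImaginaryQuadratic (hK : IsImaginaryQuadratic K) (h2 : SplitsCompletely K 2)
    (κ : ZpExtension K 2) (hκ : κ.IsCyclotomic) (hμ : ClassicalMuVanishes κ) : 1 ≤ classicalLambda κ := by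
  obtain ⟨ν, n₀, h⟩ := classicalLambda_spec κ hμ
  exact one_le_of_linear_growth_of_isImaginaryQuadratic hK h2 κ hκ h

/-- `μ = 0 ⟺ λ ≥ 1` in the tree's currency (`classicalLambda` is the junk value `0` exactly when `ClassicalMuVanishes` fails). [cite: Washington1997, §13.3 Thm. 13.13] -/
theorem classicalMuVanishes_iff_one_le_classicalLambda_of_isImaginaryQuadratic (hK : IsImaginaryQuadratic K) (h2 : SplitsCompletely K 2)
    (κ : ZpExtension K 2) (hκ : κ.IsCyclotomic) : ClassicalMuVanishes κ ↔ 1 ≤ classicalLambda κ := by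
  refine ⟨one_le_classicalLambda_of_isImaginaryQuadratic hK h2 κ hκ, fun h ↦ ?_⟩
  by_contra hμ
  have := classicalLambda_eq_zero_of_not_classicalMuVanishes κ hμ
  omega

/-- **The `ℕ`-subtraction `λ₂(K) − 1` of `meetingExponentQ` is junk-free**: `(classicalLambda κ − 1) + 1 = classicalLambda κ` under `μ = 0`, `2` split.
[cite: Washington1997, §13.3 Thm. 13.13] -/
theorem classicalLambda_sub_one_add_one_of_isImaginaryQuadratic (hK : IsImaginaryQuadratic K) (h2 : SplitsCompletely K 2)
    (κ : ZpExtension K 2) (hκ : κ.IsCyclotomic) (hμ : ClassicalMuVanishes κ) : classicalLambda κ - 1 + 1 = classicalLambda κ :=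
  Nat.sub_add_cancel (one_le_classicalLambda_of_isImaginaryQuadratic hK h2 κ hκ hμ)

/-- Heegner-hypothesis form (cell bsd-2adic's binders: `IsImaginaryQuadratic K`, `SatisfiesHeegnerHypothesis (2N) K`): `e_n < e_{n+1}` for every `n`.
[cite: Fukuda1994, Thm. 1 (1), p. 264] [cite: GrossLMS1991, §1 (p. 235)] -/
theorem classNumberPExp_lt_succ_of_satisfiesHeegnerHypothesis (hK : IsImaginaryQuadratic K) {N : ℕ}
    (hH : SatisfiesHeegnerHypothesis (2 * N) K) (κ : ZpExtension K 2) (hκ : κ.IsCyclotomic) (n : ℕ) :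
    classNumberPExp κ n < classNumberPExp κ (n + 1) :=
  classNumberPExp_lt_succ_of_isImaginaryQuadratic hK
    (splitsCompletely_of_ncard_primesOver_eq_two hK.1 Nat.prime_two (hH 2 Nat.prime_two (dvd_mul_right 2 N))) κ hκ n

/-- Heegner-hypothesis form: `μ = 0 ⟹ 1 ≤ classicalLambda κ`. [cite: Washington1997, §13.3 Thm. 13.13] [cite: GrossLMS1991, §1 (p. 235)] -/
theorem one_le_classicalLambda_of_satisfiesHeegnerHypothesis (hK : IsImaginaryQuadratic K) {N : ℕ}
    (hH : SatisfiesHeegnerHypothesis (2 * N) K) (κ : ZpExtension K 2) (hκ : κ.IsCyclotomic) (hμ : ClassicalMuVanishes κ) :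
    1 ≤ classicalLambda κ :=
  one_le_classicalLambda_of_isImaginaryQuadratic hK
    (splitsCompletely_of_ncard_primesOver_eq_two hK.1 Nat.prime_two (hH 2 Nat.prime_two (dvd_mul_right 2 N))) κ hκ hμ

/-- Heegner-hypothesis form: `μ = 0 ⟺ 1 ≤ classicalLambda κ`. [cite: Washington1997, §13.3 Thm. 13.13] [cite: GrossLMS1991, §1 (p. 235)] -/
theorem classicalMuVanishes_iff_one_le_classicalLambda_of_satisfiesHeegnerHypothesis (hK : IsImaginaryQuadratic K) {N : ℕ}
    (hH : SatisfiesHeegnerHypothesis (2 * N) K) (κ : ZpExtension K 2) (hκ : κ.IsCyclotomic) :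
    ClassicalMuVanishes κ ↔ 1 ≤ classicalLambda κ :=
  classicalMuVanishes_iff_one_le_classicalLambda_of_isImaginaryQuadratic hK
    (splitsCompletely_of_ncard_primesOver_eq_two hK.1 Nat.prime_two (hH 2 Nat.prime_two (dvd_mul_right 2 N))) κ hκ

/-- With Ferrero–Washington (tree named fact `ferreroWashington1979_classicalMuVanishes`, `μ = 0` for abelian number fields) as a displayed hypothesis:
`1 ≤ classicalLambda κ` for every cyclotomic `ℤ₂`-extension of an imaginary quadratic field in which `2` splits, `K/ℚ` being abelian. Conditional (named fact).
[cite: FerreroWashington1979, Theorem (μ = 0 for abelian fields)] [cite: Washington1997, §13.3 Thm. 13.13] -/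
theorem one_le_classicalLambda_of_isImaginaryQuadratic_of_ferreroWashington (hFW : ferreroWashington1979_classicalMuVanishes)
    [IsAbelianGalois ℚ K] (hK : IsImaginaryQuadratic K) (h2 : SplitsCompletely K 2) (κ : ZpExtension K 2) (hκ : κ.IsCyclotomic) :
    1 ≤ classicalLambda κ :=
  one_le_classicalLambda_of_isImaginaryQuadratic hK h2 κ hκ (hFW K 2 κ hκ)

end ImaginaryQuadratic

/-! ## §2 The resolvent field `ℚ(√Δ_W)` of a seed-cell curve ON the Kilford stratum -/

section Resolvent

open WeierstrassCurve Literature.NumberTheory.EllipticCurves.Greenberg1999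
  Summit.BirchSwinnertonDyer.Rank1Residual.F1Sign2
  Summit.BirchSwinnertonDyer.BirchSwinnertonDyer.Theorems.AlignedTransportAtTwoKilfordStratum
  Summit.BirchSwinnertonDyer.BirchSwinnertonDyer.Theorems.AlignedTransportAtTwoCubicClosureParity

/-- **A quadratic number field containing `d` with `d² = q`, `q < 0` a rational number that is a square in `ℚ₂`, is imaginary quadratic with `2` split
completely**: totally complex since a real embedding would make `q` a real square; `K = ℚ(d)` and `minpoly d ∣ X² − q` splits over `ℚ₂`, so `K` embeds
into `ℚ₂` (Mathlib `IntermediateField.nonempty_algHom_of_adjoin_splits`), and `K/ℚ` being Galois this gen's Galois count (`…SexticTowerGrowth` §1) gives two primes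
above `2`, both with `e = f = 1`. [cite: NeukirchANT1999, Ch. II §8 (8.1)–(8.3)] [cite: Marcus2018, Ch. 3 Thm. 21] -/
theorem isImaginaryQuadratic_and_splitsCompletely_of_sq_eq {K : Type} [Field K] [NumberField K] (hK2 : Module.finrank ℚ K = 2)
    {d : K} {q : ℚ} (hd : d ^ 2 = (q : K)) (hq : q < 0) (h2 : IsSquare (q : ℚ_[2])) :
    IsImaginaryQuadratic K ∧ SplitsCompletely K 2 := by
  haveI : IsGalois ℚ K := Literature.FieldTheory.Galois.isGalois_of_finrank_eq_two hK2
  refine ⟨IsImaginaryQuadratic.of_sq_eq hK2 (by rw [hd]; exact (eq_ratCast (algebraMap ℚ K) q).symm) hq, ?_⟩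
  -- `X² − q` splits over `ℚ₂`
  obtain ⟨r, hr⟩ := h2
  have hsplit : ((X ^ 2 - C q : ℚ[X]).map (algebraMap ℚ ℚ_[2])).Splits := by
    have hfac : (X ^ 2 - C q : ℚ[X]).map (algebraMap ℚ ℚ_[2]) = (X - C r) * (X + C r) := by
      rw [Polynomial.map_sub, Polynomial.map_pow, map_X, map_C, eq_ratCast, hr, C_mul]; ring
    rw [hfac]; exact (Splits.X_sub_C r).mul (Splits.X_add_C r)
  -- `K = ℚ(d)`: `minpoly d` has degree `2`
  have hdint : IsIntegral ℚ d := .of_finite ℚ d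
  have hdroot : aeval d (X ^ 2 - C q : ℚ[X]) = 0 := by
    simp only [map_sub, map_pow, aeval_X, aeval_C, eq_ratCast, hd, sub_self]
  have hdvd : minpoly ℚ d ∣ X ^ 2 - C q := minpoly.dvd ℚ d hdroot
  have hX0 : (X ^ 2 - C q : ℚ[X]) ≠ 0 := X_pow_sub_C_ne_zero two_pos q
  have hnot : d ∉ (algebraMap ℚ K).range := by
    rintro ⟨t, ht⟩
    rw [eq_ratCast] at ht
    have h1 : ((t ^ 2 : ℚ) : K) = (q : K) := by push_cast; rw [ht, hd]
    have h2' : t ^ 2 = q := by exact_mod_cast h1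
    nlinarith [sq_nonneg t]
  have htop : ℚ⟮d⟯ = ⊤ := by
    rw [Field.primitive_element_iff_minpoly_natDegree_eq, hK2]
    refine le_antisymm ?_ ((minpoly.two_le_natDegree_iff hdint).mpr hnot)
    have h := natDegree_le_of_dvd hdvd hX0
    rwa [natDegree_X_pow_sub_C] at h
  obtain ⟨φ⟩ : Nonempty (K →ₐ[ℚ] ℚ_[2]) :=
    IntermediateField.nonempty_algHom_of_adjoin_splits (S := ({d} : Set K)) (fun s hs ↦ by
      rw [Set.mem_singleton_iff] at hs
      subst hs
      exact ⟨hdint, hsplit.of_dvd (Polynomial.map_ne_zero hX0) (Polynomial.map_dvd _ hdvd)⟩) htop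
  -- two primes above `2`, transported to `primesOver`
  haveI : Fact (Nat.Prime 2) := ⟨Nat.prime_two⟩
  have hcount := ncard_eq_finrank_of_isGalois_of_ringHom_padic (p := 2) (φ : K →+* ℚ_[2])
  rw [hK2] at hcount
  refine splitsCompletely_of_ncard_primesOver_eq_two hK2 Nat.prime_two ?_
  have h0 : (Ideal.span {(2 : ℤ)} : Ideal ℤ) ≠ ⊥ := by rw [Ne, Ideal.span_singleton_eq_bot]; norm_num
  have himg : (fun w : HeightOneSpectrum (𝓞 K) ↦ w.asIdeal) '' {w | ((2 : ℕ) : 𝓞 K) ∈ w.asIdeal} =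
      (Ideal.span {(2 : ℤ)}).primesOver (𝓞 K) := by
    ext P
    constructor
    · rintro ⟨w, hw, rfl⟩
      exact ⟨w.isPrime, liesOver_span_of_natCast_mem_asIdeal Nat.prime_two w hw⟩
    · intro hP
      haveI := hP.1
      haveI := hP.2
      have hP0 : P ≠ ⊥ := Ideal.ne_bot_of_liesOver_of_ne_bot h0 P
      exact ⟨⟨P, hP.1, hP0⟩, natCast_mem_of_liesOver_span hP.2, rfl⟩
  have h := Set.ncard_image_of_injective {w : HeightOneSpectrum (𝓞 K) | ((2 : ℕ) : 𝓞 K) ∈ w.asIdeal}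
    (fun v w (h : v.asIdeal = w.asIdeal) ↦ HeightOneSpectrum.ext h)
  rw [himg] at h
  exact_mod_cast h.trans hcount

variable (W : WeierstrassCurve ℚ)

/-- **The resolvent field of a seed-cell curve ON the Kilford stratum.** `W/ℚ` elliptic with `Δ_W < 0`, ON the stratum (so `Δ_W ∈ ℚ₂ײ`, tree
`isSquare_padic_Δ_of_onKilfordStratumAtTwo`), `δ ∈ ℚ̄` with `δ² = Δ_W`: the number field `ℚ(δ) = ℚ(√Δ_W)` is imaginary quadratic with `2` split
(the `NumberField` structure on `ℚ(δ)` is the hypothesis `[NumberField ℚ⟮δ⟯]`, available as `NumberField.mk` once `FiniteDimensional` is in scope).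
[cite: Serre1973, Ch. II §3.3 Thm. 4] [cite: Marcus2018, Ch. 3 Thm. 21] -/
theorem isImaginaryQuadratic_and_splitsCompletely_resolvent (hΔ : W.Δ < 0) (hs : OnKilfordStratumAtTwo W)
    {δ : AlgebraicClosure ℚ} (hδ : δ ^ 2 = ((W.Δ : ℚ) : AlgebraicClosure ℚ)) [NumberField ℚ⟮δ⟯] :
    IsImaginaryQuadratic ℚ⟮δ⟯ ∧ SplitsCompletely ℚ⟮δ⟯ 2 := by
  have hsq : ¬ IsSquare W.Δ := fun ⟨r, hr⟩ ↦ by nlinarith [mul_self_nonneg r]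
  have hgen : (AdjoinSimple.gen ℚ δ) ^ 2 = ((W.Δ : ℚ) : ℚ⟮δ⟯) := by
    apply (algebraMap ℚ⟮δ⟯ (AlgebraicClosure ℚ)).injective
    rw [map_pow, AdjoinSimple.algebraMap_gen, map_ratCast, hδ]
  exact isImaginaryQuadratic_and_splitsCompletely_of_sq_eq (finrank_adjoin_eq_two_of_sq_eq hδ hsq) hgen hΔ
    (isSquare_padic_Δ_of_onKilfordStratumAtTwo W hs)

/-- **`e_n < e_{n+1}` along every cyclotomic `ℤ₂`-extension of the resolvent field `ℚ(√Δ_W)`** of a seed-cell curve ON the Kilford stratum (`Δ_W < 0`).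
[cite: Fukuda1994, Thm. 1 (1), p. 264] [cite: Lang1990, Ch. 13 §4, Lemma 4.1–4.2] -/
theorem classNumberPExp_lt_succ_resolvent (hΔ : W.Δ < 0) (hs : OnKilfordStratumAtTwo W)
    {δ : AlgebraicClosure ℚ} (hδ : δ ^ 2 = ((W.Δ : ℚ) : AlgebraicClosure ℚ)) (κ : ZpExtension ℚ⟮δ⟯ 2) (hκ : κ.IsCyclotomic) (n : ℕ) :
    classNumberPExp κ n < classNumberPExp κ (n + 1) := by
  haveI : FiniteDimensional ℚ ℚ⟮δ⟯ :=
    IntermediateField.adjoin.finiteDimensional ((AlgebraicClosure.isAlgebraic ℚ).isAlgebraic δ).isIntegral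
  haveI : NumberField ℚ⟮δ⟯ := NumberField.mk
  obtain ⟨hK, h2⟩ := isImaginaryQuadratic_and_splitsCompletely_resolvent W hΔ hs hδ
  exact classNumberPExp_lt_succ_of_isImaginaryQuadratic hK h2 κ hκ n

/-- **`μ₂(ℚ(√Δ_W)^{cyc}) = 0 ⟺ λ₂(ℚ(√Δ_W)^{cyc}) ≥ 1`** for the resolvent field of a seed-cell curve ON the Kilford stratum (`Δ_W < 0`), every cyclotomic `κ`.
[cite: Washington1997, §13.3 Thm. 13.13] [cite: Lang1990, Ch. 13 §4, Lemma 4.1–4.2] -/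
theorem classicalMuVanishes_iff_one_le_classicalLambda_resolvent (hΔ : W.Δ < 0) (hs : OnKilfordStratumAtTwo W)
    {δ : AlgebraicClosure ℚ} (hδ : δ ^ 2 = ((W.Δ : ℚ) : AlgebraicClosure ℚ)) (κ : ZpExtension ℚ⟮δ⟯ 2) (hκ : κ.IsCyclotomic) :
    ClassicalMuVanishes κ ↔ 1 ≤ classicalLambda κ := by
  haveI : FiniteDimensional ℚ ℚ⟮δ⟯ :=
    IntermediateField.adjoin.finiteDimensional ((AlgebraicClosure.isAlgebraic ℚ).isAlgebraic δ).isIntegral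
  haveI : NumberField ℚ⟮δ⟯ := NumberField.mk
  obtain ⟨hK, h2⟩ := isImaginaryQuadratic_and_splitsCompletely_resolvent W hΔ hs hδ
  exact classicalMuVanishes_iff_one_le_classicalLambda_of_isImaginaryQuadratic hK h2 κ hκ

/-- Ferrero–Washington-discharged (named fact as hypothesis; `ℚ(δ)/ℚ` is abelian): **`λ₂(ℚ(√Δ_W)^{cyc}) ≥ 1`** ON the Kilford stratum, `Δ_W < 0`. Conditional.
[cite: FerreroWashington1979, Theorem (μ = 0 for abelian fields)] [cite: Washington1997, §13.3 Thm. 13.13] -/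
theorem one_le_classicalLambda_resolvent_of_ferreroWashington (hFW : ferreroWashington1979_classicalMuVanishes) (hΔ : W.Δ < 0)
    (hs : OnKilfordStratumAtTwo W) {δ : AlgebraicClosure ℚ} (hδ : δ ^ 2 = ((W.Δ : ℚ) : AlgebraicClosure ℚ))
    (κ : ZpExtension ℚ⟮δ⟯ 2) (hκ : κ.IsCyclotomic) : 1 ≤ classicalLambda κ := by
  haveI : FiniteDimensional ℚ ℚ⟮δ⟯ :=
    IntermediateField.adjoin.finiteDimensional ((AlgebraicClosure.isAlgebraic ℚ).isAlgebraic δ).isIntegral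
  haveI : NumberField ℚ⟮δ⟯ := NumberField.mk
  obtain ⟨hK, h2⟩ := isImaginaryQuadratic_and_splitsCompletely_resolvent W hΔ hs hδ
  haveI : IsGalois ℚ ℚ⟮δ⟯ := Literature.FieldTheory.Galois.isGalois_of_finrank_eq_two hK.1
  haveI : Fact (Nat.Prime 2) := ⟨Nat.prime_two⟩
  have hcard : Nat.card (ℚ⟮δ⟯ ≃ₐ[ℚ] ℚ⟮δ⟯) = 2 := by rw [IsGalois.card_aut_eq_finrank, hK.1]
  haveI : IsCyclic (ℚ⟮δ⟯ ≃ₐ[ℚ] ℚ⟮δ⟯) := isCyclic_of_prime_card hcard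
  haveI : IsAbelianGalois ℚ ℚ⟮δ⟯ := ⟨⟩
  exact one_le_classicalLambda_of_isImaginaryQuadratic hK h2 κ hκ (hFW ℚ⟮δ⟯ 2 κ hκ)

end Resolvent

end Summit.BirchSwinnertonDyer.BirchSwinnertonDyer.Theorems.AlignedTransportAtTwoGreenbergFieldLambda

end
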